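import Summits.NavierStokesRegularity.NavierStokesRegularity.Theorems.HeredityFromTwoT.Negative.HeredityFromTwoTFalseOfNoSwirlRungT
import Summits.NavierStokesRegularity.FluidComputer.PalasekTowerLiveClassAtHelicity
import Summits.NavierStokesRegularity.FluidComputer.PalasekTowerRegisterWindow
import Literature.Analysis.FluidPDE.NSLerayHopfSereginEnergyProofs
import Summits.NavierStokesRegularity.NavierStokesRegularity.Theorems.HeredityAtOneT.Negative.SterileGlobalOpenL3
import Summits.NavierStokesRegularity.NavierStokesRegularity.Theorems.HeredityAtOneT.Negative.LiveConfinedDataDense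
import Literature.Analysis.FluidPDE.AxisymmetricReflection
import Literature.Analysis.FluidPDE.TaoClassSymmetry
import Literature.Analysis.FluidPDE.ClassicalSolutionRescale
import Literature.Analysis.FluidPDE.NSBackwardUniquenessFiniteEnergy
import Summits.NavierStokesRegularity.NavierStokesRegularity.Theorems.PalasekTowerBreakdownEpisodeBaseTShadowRegisters
import Summits.NavierStokesRegularity.NavierStokesRegularity.Theorems.HeredityAtOneT.Negative.DeadSliceBackwardStage

/-!
# ROBUST MIRROR — the swirl-free («mirrorT») decider in OPEN form, and what it decides in the kernel

Cell `ns-blowup`, seat `cstrat-stmt-NavierStokesRegularity-19179` (g2; crux-strategist of route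
`PalasekTowerBreakdown` rev 19; crux of record stmt-NavierStokesRegularity-20303 `EpisodeBaseT`, negation-lens
target stmt-…-20304 `HeredityAtOneT` / -20305 `HeredityFromTwoT`). LABEL: E–C typing (crux-chain SKELETON:
named open `Prop`s = stubs, `sorry` ONLY inside `stub_*`, and sorry-free compositions). WHAT THIS IS NOT: not
Navier–Stokes evidence — no flow, stage, design or tower is constructed; nothing below is asserted except the
compositions, which are theorems of logic over the tree.

## The point (DIRECTOR-NS #48 (3) «mirrorT = ∀-typing DECIDER», #49 (2); answered in typed form)

**STATE v7 (2026-08-27T18:30Z): ONE stub left — T1 `stub_slack_facesT : SlackFacesT` (the sterile 2-D certificate WITH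
SLACK) — and NO hypothesis anywhere else: every other statement of the line is a TREE THEOREM.** T2 `ShadowRegistersT` =
`Theorems.palasekTowerBreakdown_shadowRegistersT` (p548396, ecbridge-3); S2/S4 = p542725 / p543875 (refuter4); S3
`LiveDatumPropagatesT` = `HeredityAtOneTDeadSliceBackwardStage.liveDatumPropagates TowerRates.tuned` (p552342, refuter4 K224:
backward uniqueness in the `L²`-Sobolev class after Temam, every registered unforced stage being in Tao's class — the
Literature named fact `ns_backward_uniqueness_finiteEnergy` of v5/v6 is NO LONGER USED by the bottom lines; the v5 reduction
`liveDatumPropagatesT_of_literature` is kept as an alternative proof). Bottom lines, all from T1 ALONE: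
`EpisodeBaseT_of₁ : SlackFacesT → EpisodeBaseT`, `not_heredityPairT_of₁ : SlackFacesT → ¬ (HeredityAtOneT ∧ HeredityFromTwoT)`,
`not_liveHeredityPairT_of₁ : SlackFacesT → ¬ (LiveHeredityAtOneT ∧ LiveHeredityFromTwoT)`,
`robust_mirror_decides₁ : SlackFacesT → (EpisodeBaseT ∧ LiveEpisodeBaseT) ∧ ¬ (LiveHeredityAtOneT ∧ LiveHeredityFromTwoT) ∧
¬ (HeredityAtOneT ∧ HeredityFromTwoT)`. STATUS OF T1 (MODEL, tranche 0, census l.10255): NOT met by the registered sterile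
head-on family S1–S10 (binding face: the level-1 gradient; structural miss: far field F2 vs ring expansion); the
STERILE-DOOR test (DIRECTOR-NS #74/#75) probes the margin under READING 2 (door box) — see `Lines/robustmirror.md` v7.

K201 (`HeredityFromTwoTFalseOfNoSwirlRungT`, refuter4) shows: ONE swirl-free registered tuned level-1 design
(`NoSwirlRungAtOneT`) proves `EpisodeBaseT` and refutes the PAIR `HeredityAtOneT ∧ HeredityFromTwoT`. The planner's
SHELF repair (`PalasekTowerLiveClassAt`: heredity asked only of LIVE stages, `LiveHeredityAtGAt` / `LiveHeredityFromGAt`)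
survives that decider because a sterile witness is not live. THIS FILE: if the swirl-free design registers ROBUSTLY
(`RobustNoSwirlRungAtOneT`: registration at level 1 is OPEN in the confined datum, C¹ topology — what any certificate
WITH SLACK delivers, see `SlackFacesT` / `ShadowRegistersT`), then, by three further statements each of which is a
theorem in print (the FIRST and THIRD now tree theorems: `sterileGlobalOpenT_holds` p542725, `liveConfinedDataDense_holds` p543875) —
* `SterileGlobalOpenT`: global regularity is OPEN in `L³` around a swirl-free datum (Ladyzhenskaya–Ukhovskii–Yudovich
  = tree `axisymmetric_no_swirl_global_regularity_holds`; Gallagher–Iftimie–Planchon 2003 Thm 0.1 = tree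
  `GIP2003_L3_stability_holds`; Kato ⇒ Clay = tree `clay_solution_of_hasGlobalKatoSolution_holds`),
* `LiveDatumPropagatesT`: for an UNFORCED design a non-dead datum gives a non-dead readout slice at every level it
  registers — since v7 a TREE THEOREM used by name (`liveDatumPropagatesT_holds` :=
  `HeredityAtOneTDeadSliceBackwardStage.liveDatumPropagates TowerRates.tuned`, p552342: backward uniqueness in the
  `L²`-Sobolev class `IsClassicalNSSolutionOn.backward_unique_of_sobolev` (Temam 1977 Ch. III §6 Lemma 6.2) + Tao's class for
  registered stages + the `O(2)`-fixed-point characterisation of dead slices); the v4/v5 in-file reduction to the Literature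
  named fact `ns_backward_uniqueness_finiteEnergy` (`liveDatumPropagatesT_of_literature`) stays as a second proof,
* `LiveConfinedDataDense`: next to any confined smooth divergence-free datum there are confined smooth
  divergence-free data with non-vanishing helicity density, arbitrarily close in `C¹` and `L³` (elementary),
— an `L³`-OPEN set of LIVE, GLOBALLY REGULAR tuned designs registers level 1, so the LIVE pair dies too:
`not_liveHeredityPairT_of` : … → ¬ (LiveHeredityAtOneT ∧ LiveHeredityFromTwoT)`, and of course
`not_heredityPairT_of`. Excising a nowhere-dense class (dead slices, zero helicity, any symmetry stratum) is NOT a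
repair; only a QUANTITATIVE liveness floor that excludes an `L³`-neighbourhood of the sterile registering designs
could be. The same stubs give the constructive reading of 20303: `EpisodeBaseT_of` (sterile certificate with
slack + shadow lemma) and `liveEpisodeBaseT_of` (+ δ-swirl: the SHELF base `LiveEpisodeBaseT` from a 2-D
computation; the helicity rider «≠ 0» separates nothing).

References: I. Gallagher, D. Iftimie, F. Planchon, Ann. Inst. Fourier 53 (2003) Thm 0.1
[cite: GallagherIftimiePlanchon2003, Thm. 0.1 (p. 1389)]; C. Bardos, L. Tartar, Arch. Rational Mech. Anal. 50
(1973) 10–25 (backward uniqueness for Navier–Stokes) [cite: BardosTartar1973, Thm. II.1]; L. Escauriaza,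
G. Seregin, V. Šverák, Russian Math. Surveys 58 (2003) [cite: EscauriazaSereginSverak2003, Thm. 1.1];
P. G. Lemarié-Rieusset (2016) Thm 10.4 [cite: LemarieRieusset2016, Thm 10.4 (p. 285)]; T. Tao, Anal. PDE 6 (2013)
Thm 5.4 [cite: Tao2011, Thm. 5.4 (ii)+(iv)]; S. Palasek, arXiv:2605.13827 §4 [cite: Palasek2026ElementaryModel, §4].
-/

noncomputable section

namespace Summit.NavierStokesRegularity.NavierStokesRegularity.Cruxes.EpisodeBaseT.RobustMirror

open Set MeasureTheory Filter Topology Function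
open scoped ENNReal ContDiff NNReal
open Literature.Analysis.FluidPDE
open Summit.NavierStokesRegularity.FluidComputer.PalasekTowerClayBridge
open Summit.NavierStokesRegularity.HeredityAtOneSpeedCap
open Summit.NavierStokesRegularity.HeredityFromTwoTNoSwirl
open Summit.NavierStokesRegularity.NavierStokesRegularity.Theses

/-! ## §1 The statements (named `Prop`s; S2, S3, S4, T2 are tree theorems since v7; `sorry` only in `stub_*` = T1) -/

/-- **S1 — ROBUST swirl-free rung at level 1 (the OPEN form of the mirrorT decider; open; never asserted).**
Some pinned rigid quiet UNFORCED tuned design with axisymmetric swirl-free datum, confined to a ball of positive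
radius, registers a level-1 stage, AND registration is OPEN at it: every smooth divergence-free rapidly decaying
datum confined to the same ball and `ε`-close in value and gradient is the datum of SOME pinned rigid quiet
unforced tuned design registering a level-1 stage (the design re-timed at its own first hitting time). Split below
as `SlackFacesT` (2-D certificate with slack) + `ShadowRegistersT` (perturbation lemma). [cite: Palasek2026ElementaryModel, §4] -/
def RobustNoSwirlRungAtOneT : Prop :=
  ∃ S : Schedule TowerRates.tuned,
    S.Pins 8 (6 / 5) ∧ S.Rigid ∧ S.Quiet ∧ NoSwirlDesign S ∧ S.f = 0 ∧ 0 < S.radius ∧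
    Nonempty (Stage 1 TowerRates.tuned S (Margins.routeG TowerRates.tuned) 1) ∧
    ∃ ε : ℝ, 0 < ε ∧
      ∀ a : EuclideanSpace ℝ (Fin 3) → EuclideanSpace ℝ (Fin 3),
        ContDiff ℝ ∞ a → VectorCalculus.IsDivFree a → HasRapidSpatialDecay a →
        (∀ x, S.radius < ‖x‖ → a x = 0) →
        (∀ x, ‖a x - S.u₀ x‖ ≤ ε) → (∀ x, ‖fderiv ℝ a x - fderiv ℝ S.u₀ x‖ ≤ ε) →
        ∃ S' : Schedule TowerRates.tuned,
          S'.u₀ = a ∧ S'.f = 0 ∧ S'.Pins 8 (6 / 5) ∧ S'.Rigid ∧ S'.Quiet ∧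
          Nonempty (Stage 1 TowerRates.tuned S' (Margins.routeG TowerRates.tuned) 1)

/-- **S2 — global regularity is OPEN in `L³` around a swirl-free Clay datum, classical rendering (in print; every
ingredient is a theorem of the tree: LUY `axisymmetric_no_swirl_global_regularity_holds`, GIP 2003 Thm 0.1
`GIP2003_L3_stability_holds`, Kato ⇒ Clay `clay_solution_of_hasGlobalKatoSolution_holds`; the missing glue is
«global classical bounded-energy solution from a Schwartz datum ⇒ `HasGlobalKatoSolution 1 u₀`»).
[cite: GallagherIftimiePlanchon2003, Thm. 0.1 (p. 1389)] -/
def SterileGlobalOpenT : Prop :=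
  ∀ u₀ : EuclideanSpace ℝ (Fin 3) → EuclideanSpace ℝ (Fin 3),
    ContDiff ℝ ∞ u₀ → VectorCalculus.IsDivFree u₀ → HasRapidSpatialDecay u₀ →
    IsAxisymmetric u₀ → HasNoSwirl u₀ →
    ∃ ε : ℝ, 0 < ε ∧
      ∀ a : EuclideanSpace ℝ (Fin 3) → EuclideanSpace ℝ (Fin 3),
        ContDiff ℝ ∞ a → VectorCalculus.IsDivFree a → HasRapidSpatialDecay a →
        eLpNorm (a - u₀) 3 volume < ENNReal.ofReal ε →
        ∃ (U : ℝ → EuclideanSpace ℝ (Fin 3) → EuclideanSpace ℝ (Fin 3))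
          (P : ℝ → EuclideanSpace ℝ (Fin 3) → ℝ),
          IsClassicalNSSolutionOn (Ici 0) 1 0 U P ∧ U 0 = a ∧ HasBoundedEnergy U

/-- **S3 — a live datum stays live along an UNFORCED registered design** (backward uniqueness content; open here,
in print): if the datum of an unforced tuned design is not a dead slice, then no registered stage of it (any level)
has a dead readout slice — a dead slice at `τ_k` is `O(2)`-equivariant in some rigid placement, each rigid motion
carries classical solutions to classical solutions, two bounded classical finite-energy solutions of the free
system on `[0, τ_k]` that agree at `τ_k` agree at `0` (Bardos–Tartar; ESŠ), so the datum would be dead.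
[cite: EscauriazaSereginSverak2003, Thm. 1.1] [cite: BardosTartar1973, Thm. II.1] -/
def LiveDatumPropagatesT : Prop :=
  ∀ S : Schedule TowerRates.tuned, S.f = 0 → ∀ (k : ℕ)
    (s : Stage 1 TowerRates.tuned S (Margins.routeG TowerRates.tuned) k),
    ¬ DeadSlice S.u₀ → LiveStageAt TowerRates.tuned S s

/-- **S4 — live confined data are dense (elementary; open here).** Next to any smooth divergence-free datum confined
to a ball of radius `r > 0` there is, for every `ε > 0`, a smooth divergence-free rapidly decaying datum confined to
the same ball, `ε`-close in value, in gradient and in `L³`, which is NOT a dead slice (add `δ · w`, `w` a compactly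
supported divergence-free field with `w · curl w ≢ 0`; the helicity density at a point is a quadratic polynomial in
`δ` with non-zero leading coefficient; `not_deadSlice_of_inner_self_curl_ne_zero`). [cite: Moffatt1969, §1] -/
def LiveConfinedDataDense : Prop :=
  ∀ (u₀ : EuclideanSpace ℝ (Fin 3) → EuclideanSpace ℝ (Fin 3)) (r ε : ℝ), 0 < r → 0 < ε →
    ContDiff ℝ ∞ u₀ → VectorCalculus.IsDivFree u₀ → (∀ x, r < ‖x‖ → u₀ x = 0) →
    ∃ a : EuclideanSpace ℝ (Fin 3) → EuclideanSpace ℝ (Fin 3),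
      ContDiff ℝ ∞ a ∧ VectorCalculus.IsDivFree a ∧ HasRapidSpatialDecay a ∧
      (∀ x, r < ‖x‖ → a x = 0) ∧ (∀ x, ‖a x - u₀ x‖ ≤ ε) ∧
      (∀ x, ‖fderiv ℝ a x - fderiv ℝ u₀ x‖ ≤ ε) ∧
      eLpNorm (a - u₀) 3 volume < ENNReal.ofReal ε ∧ ¬ DeadSlice a

/-! ### The split of S1: a sterile 2-D certificate WITH SLACK, and the shadow (re-timing) lemma -/

/-- **Faces with slack** for the FREE run from the datum `u₀` (unit viscosity, tuned faces, `c₁ = 1`, `c₂ = 5/3`,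
window `w₀ = tuned.window 0`), read in the ball of radius `r₁`: a classical finite-energy free run `(u, p)` on
`[0, τ₀ + w₀ + η]` with slack `η > 0` in EVERY registered clause of a level-1 `routeG` stage and slack in TIME
(`± η` around both readouts), a TRANSVERSAL first up-crossing of the level-0 floor speed `Y₀` at `τ₀` (rate `≥ η`),
and the far field below `Y₀ − η` outside the ball `r₁` — exactly what a validated 2-D (axisymmetric, swirl-free)
computation with interval slack outputs. [cite: Palasek2026ElementaryModel, §3.3, §4] -/
def SlackFaces (u₀ : EuclideanSpace ℝ (Fin 3) → EuclideanSpace ℝ (Fin 3)) (r₁ : ℝ) : Prop :=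
  ∃ (u : ℝ → EuclideanSpace ℝ (Fin 3) → EuclideanSpace ℝ (Fin 3)) (p : ℝ → EuclideanSpace ℝ (Fin 3) → ℝ)
    (τ₀ η : ℝ),
    0 < η ∧ η < τ₀ ∧ η < TowerRates.tuned.window 0 ∧
    IsClassicalNSSolutionOn (Icc 0 (τ₀ + TowerRates.tuned.window 0 + η)) 1 0 u p ∧ u 0 = u₀ ∧
    (∃ C : ℝ≥0∞, C < ⊤ ∧ ∀ t ∈ Icc 0 (τ₀ + TowerRates.tuned.window 0 + η), ∫⁻ x, ‖u t x‖ₑ ^ 2 ≤ C) ∧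
    -- (F0) global anchor, early part: strictly below the level-0 floor everywhere
    (∀ t ∈ Icc 0 (τ₀ - η), ∀ x, ‖u t x‖ ≤ TowerRates.tuned.Y 0 - η) ∧
    -- (F1) transversal up-crossing of `Y₀` at `τ₀`, from below everywhere and from above inside the ball
    (∀ t ∈ Icc (τ₀ - η) τ₀, ∀ x, ‖u t x‖ ≤ TowerRates.tuned.Y 0 - η * (τ₀ - t)) ∧
    (∀ t ∈ Icc τ₀ (τ₀ + η), ∃ x, ‖x‖ ≤ r₁ ∧ TowerRates.tuned.Y 0 + η * (t - τ₀) ≤ ‖u t x‖) ∧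
    -- (F2) far field: outside the ball the speed never reaches the level-0 floor
    (∀ t ∈ Icc 0 (τ₀ + TowerRates.tuned.window 0 + η), ∀ x, r₁ < ‖x‖ → ‖u t x‖ ≤ TowerRates.tuned.Y 0 - η) ∧
    -- (F3) level-1 velocity floor with slack, robust in time
    (∀ t ∈ Icc (τ₀ + TowerRates.tuned.window 0 - η) (τ₀ + TowerRates.tuned.window 0 + η),
      ∃ x, ‖x‖ ≤ r₁ ∧ TowerRates.tuned.Y 1 + η ≤ ‖u t x‖) ∧
    -- (F4) level-1 ceiling with slack on the whole slab; (F5) level-0 ceiling / quiet clause with slack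
    (∀ t ∈ Icc 0 (τ₀ + TowerRates.tuned.window 0 + η), ∀ x, ‖u t x‖ ≤ 5 / 3 * TowerRates.tuned.Y 1 - η) ∧
    (∀ t ∈ Icc 0 (τ₀ + η), ∀ x, ‖u t x‖ ≤ 5 / 3 * TowerRates.tuned.Y 0 - η) ∧
    -- (F6) strain floors of levels 0 and 1 with slack, robust in time
    (∀ t ∈ Icc (τ₀ - η) (τ₀ + η), ∃ x, ‖x‖ ≤ r₁ ∧ TowerRates.tuned.A 0 + η ≤ ‖fderiv ℝ (u t) x‖) ∧
    (∀ t ∈ Icc (τ₀ + TowerRates.tuned.window 0 - η) (τ₀ + TowerRates.tuned.window 0 + η),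
      ∃ x, ‖x‖ ≤ r₁ ∧ TowerRates.tuned.A 1 + η ≤ ‖fderiv ℝ (u t) x‖) ∧
    -- (F7) core ledger of levels 0 and 1 with slack, robust in time
    (∀ t ∈ Icc (τ₀ - η) (τ₀ + η), ∃ (x : EuclideanSpace ℝ (Fin 3)) (γ : ℝ → EuclideanSpace ℝ (Fin 3)),
      ‖x‖ ≤ r₁ ∧ ContDiff ℝ 1 γ ∧ γ 0 = γ 1 ∧
      (∀ s ∈ Icc (0 : ℝ) 1, γ s ∈ Metric.closedBall x (1 / TowerRates.tuned.N 0)) ∧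
      (∀ s ∈ Icc (0 : ℝ) 1, ‖deriv γ s‖ ≤ 8 * Real.pi / TowerRates.tuned.N 0) ∧
      TowerRates.tuned.N 0 ^ (TowerRates.tuned.β - 2) + η ≤ circulation (u t) γ) ∧
    (∀ t ∈ Icc (τ₀ + TowerRates.tuned.window 0 - η) (τ₀ + TowerRates.tuned.window 0 + η),
      ∃ (x : EuclideanSpace ℝ (Fin 3)) (γ : ℝ → EuclideanSpace ℝ (Fin 3)),
      ‖x‖ ≤ r₁ ∧ ContDiff ℝ 1 γ ∧ γ 0 = γ 1 ∧
      (∀ s ∈ Icc (0 : ℝ) 1, γ s ∈ Metric.closedBall x (1 / TowerRates.tuned.N 1)) ∧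
      (∀ s ∈ Icc (0 : ℝ) 1, ‖deriv γ s‖ ≤ 8 * Real.pi / TowerRates.tuned.N 1) ∧
      TowerRates.tuned.N 1 ^ (TowerRates.tuned.β - 2) + η ≤ circulation (u t) γ)

/-- **T1 — the sterile 2-D certificate with slack (open; the mirrorT COMPUTATION).** Some smooth divergence-free
axisymmetric swirl-free datum confined to a ball `B(0, r)`, `0 < r₁ ≤ r`, whose free run has `SlackFaces u₀ r₁`.
Global smooth existence of the run is the tree's theorem (LUY); the content is purely quantitative on a finite
window, in the `(r, z)` half-plane. [cite: Palasek2026ElementaryModel, §4] [cite: LemarieRieusset2016, Thm 10.4 (p. 285)] -/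
def SlackFacesT : Prop :=
  ∃ (u₀ : EuclideanSpace ℝ (Fin 3) → EuclideanSpace ℝ (Fin 3)) (r r₁ : ℝ),
    0 < r₁ ∧ r₁ ≤ r ∧ ContDiff ℝ ∞ u₀ ∧ VectorCalculus.IsDivFree u₀ ∧ (∀ x, r < ‖x‖ → u₀ x = 0) ∧
    IsAxisymmetric u₀ ∧ HasNoSwirl u₀ ∧ SlackFaces u₀ r₁

/-- **T2 — the SHADOW (re-timing) lemma (a THEOREM since v6: `shadowRegistersT_holds` = `Theorems.palasekTowerBreakdown_shadowRegistersT`,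
p548396; originally: finite-window stability bookkeeping over the tree's
`PerturbedDatum.exists_free_run_near_of_datum`, `PerturbedRun.norm_fderiv_sub_le_final`, continuity of
`circulation` in the sup norm, and a `τ₀`-generic twin of `Schedule.ofBoxAt`).** Faces with slack for the free run
from a confined datum `u₀` make registration OPEN at `u₀`: every smooth divergence-free rapidly decaying datum
confined to the same ball and `ε`-close in value and gradient (including `u₀` itself) is the datum of a pinned
rigid quiet UNFORCED tuned design of radius `r` registering a level-1 `routeG` stage — re-timed at its own
(transversal, hence `O(ε/η)`-shifted) first hitting time. [cite: Tao2011, Thm. 5.4 (ii)+(iv)] [cite: Palasek2026ElementaryModel, §3.3] -/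
def ShadowRegistersT : Prop :=
  ∀ (u₀ : EuclideanSpace ℝ (Fin 3) → EuclideanSpace ℝ (Fin 3)) (r r₁ : ℝ),
    0 < r₁ → r₁ ≤ r → ContDiff ℝ ∞ u₀ → VectorCalculus.IsDivFree u₀ → (∀ x, r < ‖x‖ → u₀ x = 0) →
    SlackFaces u₀ r₁ →
    ∃ ε : ℝ, 0 < ε ∧
      ∀ a : EuclideanSpace ℝ (Fin 3) → EuclideanSpace ℝ (Fin 3),
        ContDiff ℝ ∞ a → VectorCalculus.IsDivFree a → HasRapidSpatialDecay a →
        (∀ x, r < ‖x‖ → a x = 0) →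
        (∀ x, ‖a x - u₀ x‖ ≤ ε) → (∀ x, ‖fderiv ℝ a x - fderiv ℝ u₀ x‖ ≤ ε) →
        ∃ S' : Schedule TowerRates.tuned,
          S'.u₀ = a ∧ S'.f = 0 ∧ S'.radius = r ∧ S'.Pins 8 (6 / 5) ∧ S'.Rigid ∧ S'.Quiet ∧
          Nonempty (Stage 1 TowerRates.tuned S' (Margins.routeG TowerRates.tuned) 1)

/-- stub (T1): the sterile 2-D certificate with slack. [cite: Palasek2026ElementaryModel, §4] -/
theorem stub_slack_facesT : SlackFacesT := by
  sorry

/-- **T2 is a THEOREM** (v6): the shadow / re-timing lemma, landed BY ITS UNFOLDED TEXT as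
`Theorems.palasekTowerBreakdown_shadowRegistersT` (p548396 ACCEPTED c2a97f0e126f, ns-blowup-ecbridge-3 g10, over
`FluidComputer/PalasekTowerShadowSchedule` p545775 — the τ₀-generic unforced twin `Schedule.ofWindowsFrom` of `ofBoxAt` —,
`PalasekTowerShadowRun` p546617 — the C¹ shadow `FreeRun.exists_C1_shadow`, first hitting time `exists_isLeast_floorTime`,
`circulation_ge_of_near` —, and `PalasekTowerShadowRegistration` p547512 — `Shadow.registration_open` at every
register-admissible `R`). [cite: Tao2011, Thm. 5.4 (ii)+(iv)] [cite: KochNadirashviliSereginSverak2009, §4 (4.10)] -/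
theorem shadowRegistersT_holds : ShadowRegistersT :=
  Summit.NavierStokesRegularity.NavierStokesRegularity.Theorems.palasekTowerBreakdown_shadowRegistersT

/-- **S2 is a THEOREM** (landed p542725 `Theorems/HeredityAtOneT/Negative/SterileGlobalOpenL3.lean`: LUY
`axisymmetric_no_swirl_global_regularity_holds` + the glue `hasGlobalKatoSolution_of_global_classical` + GIP 2003
`GIP2003_L3_stability_holds` + Kato ⇒ Clay `clay_solution_of_hasGlobalKatoSolution_holds`).
[cite: GallagherIftimiePlanchon2003, Thm. 0.1 (p. 1389)] -/
theorem sterileGlobalOpenT_holds : SterileGlobalOpenT :=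
  Summit.NavierStokesRegularity.SterileGlobalOpenL3.exists_L3_ball_global_classical_of_axisym_noSwirl

/-- **BU — backward uniqueness of bounded finite-energy classical Navier–Stokes solutions on `ℝ³`** (a RESULT IN
PRINT, typed here as the exact input of S3; cite item filed 2026-08-27T15:58Z «fact: Navier–Stokes backward uniqueness
…»): two classical solutions of the free system (`ν > 0`, force `0`) on the closed slab `[0, T] × ℝ³`, each with
bounded velocity and uniformly bounded energy on the slab (the `Stage` class: `Stage.ceiling`, `Stage.energy`), which
agree at time `T`, agree at time `0`. Proof in print: finite-energy classical ⇒ Leray–Hopf (Tao 2011, Lemma 8.1, tree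
`IsClassicalNSSolutionOn.isLerayHopfOn_of_finiteEnergy`), bounded ⇒ smooth with bounded gradients on `[δ, T]`
(Serrin), then the abstract log-convexity theorem for `w = u₁ − u₂`, `w′ + Aw = −P(w·∇u₁ + u₂·∇w)`, `A = −PΔ`,
`‖P(…)‖₂ ≤ ‖∇u₁‖_∞ ‖w‖₂ + ‖u₂‖_∞ ‖A^{1/2} w‖₂` (Kukavica 2007, Thm. 2.1, classical case = Ogawa / Bardos–Tartar /
Ghidaglia), and `δ → 0` by continuity of the slices. [cite: BardosTartar1973, Thm. II.1] -/
def NSBackwardUniquenessFE : Prop :=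
  ∀ (ν T : ℝ) (u₁ u₂ : ℝ → EuclideanSpace ℝ (Fin 3) → EuclideanSpace ℝ (Fin 3))
    (p₁ p₂ : ℝ → EuclideanSpace ℝ (Fin 3) → ℝ), 0 < ν → 0 < T →
    IsClassicalNSSolutionOn (Icc 0 T) ν 0 u₁ p₁ → IsClassicalNSSolutionOn (Icc 0 T) ν 0 u₂ p₂ →
    (∃ C : ℝ, ∀ t ∈ Icc 0 T, ∀ x, ‖u₁ t x‖ ≤ C) → (∃ C : ℝ, ∀ t ∈ Icc 0 T, ∀ x, ‖u₂ t x‖ ≤ C) →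
    (∃ A : ℝ≥0∞, A < ⊤ ∧ ∀ t ∈ Icc 0 T, ∫⁻ x, ‖u₁ t x‖ₑ ^ 2 ≤ A) →
    (∃ A : ℝ≥0∞, A < ⊤ ∧ ∀ t ∈ Icc 0 T, ∫⁻ x, ‖u₂ t x‖ₑ ^ 2 ≤ A) →
    u₁ T = u₂ T → u₁ 0 = u₂ 0

/-- `NSBackwardUniquenessFE` IS the Literature named fact `ns_backward_uniqueness_finiteEnergy` (landed p547607,
`Literature/Analysis/FluidPDE/NSBackwardUniquenessFiniteEnergy.lean`) up to the order of binders. [cite: BardosTartar1973, Thm. II.1] -/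
theorem nsBackwardUniquenessFE_iff : NSBackwardUniquenessFE ↔ ns_backward_uniqueness_finiteEnergy :=
  ⟨fun h ν T hν hT u₁ u₂ p₁ p₂ => h ν T u₁ u₂ p₁ p₂ hν hT, fun h ν T u₁ u₂ p₁ p₂ hν hT => h ν T hν hT u₁ u₂ p₁ p₂⟩

/-- The Literature fact, in the binder order used below (no stub: the fact enters BY NAME as a hypothesis, v5). -/
theorem nsBackwardUniquenessFE_of_literature (h : ns_backward_uniqueness_finiteEnergy) : NSBackwardUniquenessFE :=
  nsBackwardUniquenessFE_iff.2 h

section S3Reduction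

variable {R : TowerRates}

/-- The run of a stage, read in a rigid placement `x ↦ A x + b`: `(t, x) ↦ A⁻¹ (u (t, A x + b))`; its slices are the
`conjSlice A b` of the slices. [folklore] -/
theorem conjSlice_run_apply (A : EuclideanSpace ℝ (Fin 3) ≃ₗᵢ[ℝ] EuclideanSpace ℝ (Fin 3))
    (b : EuclideanSpace ℝ (Fin 3)) (u : ℝ → EuclideanSpace ℝ (Fin 3) → EuclideanSpace ℝ (Fin 3)) (t : ℝ) :
    (fun x => A.symm (u t (b + A.symm.symm x))) = conjSlice A b (u t) := by
  funext x
  simp only [conjSlice, LinearIsometryEquiv.symm_symm, add_comm b]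

/-- **Rigid-motion covariance of the free system on a closed slab**: if `(u, p)` is a classical solution with force `0`
on `[0, T]`, so is its reading `(t, x) ↦ A⁻¹ u(t, A x + b)`, `p(t, A x + b)` in any rigid placement (space translation,
`IsClassicalNSSolutionOn.spaceTranslate`, then isometry conjugation, `IsClassicalNSSolutionOn.conj_linearIsometryEquiv`).
[cite: MajdaBertozziCUP2002, §1.2 Prop. 1.1 (iii)] -/
theorem isClassicalNSSolutionOn_conjSlice {ν T : ℝ} (hT : 0 < T)
    {u : ℝ → EuclideanSpace ℝ (Fin 3) → EuclideanSpace ℝ (Fin 3)} {p : ℝ → EuclideanSpace ℝ (Fin 3) → ℝ}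
    (h : IsClassicalNSSolutionOn (Icc 0 T) ν 0 u p)
    (A : EuclideanSpace ℝ (Fin 3) ≃ₗᵢ[ℝ] EuclideanSpace ℝ (Fin 3)) (b : EuclideanSpace ℝ (Fin 3)) :
    IsClassicalNSSolutionOn (Icc 0 T) ν 0 (fun t => conjSlice A b (u t)) (fun t x => p t (A x + b)) := by
  have h1 : IsClassicalNSSolutionOn (Icc 0 T) ν (fun t x => (0 : ℝ → EuclideanSpace ℝ (Fin 3) → EuclideanSpace ℝ (Fin 3)) t (b + x))
      (fun t x => u t (b + x)) (fun t x => p t (b + x)) := h.spaceTranslate b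
  have h2 := h1.conj_linearIsometryEquiv (R := A.symm) (uniqueDiffOn_Icc hT)
  have h3 : IsClassicalNSSolutionOn (Icc 0 T) ν 0 (fun t x => A.symm (u t (b + A.symm.symm x)))
      (fun t x => p t (b + A.symm.symm x)) :=
    h2.congr_force fun t _ x => by simp
  have hu : (fun t x => A.symm (u t (b + A.symm.symm x))) = fun t => conjSlice A b (u t) :=
    funext fun t => conjSlice_run_apply A b u t
  have hp : (fun t x => p t (b + A.symm.symm x)) = fun t x => p t (A x + b) := by
    funext t x; simp only [LinearIsometryEquiv.symm_symm, add_comm b]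
  rw [hu, hp] at h3
  exact h3

/-- Isometry conjugation of a free classical solution on a closed slab (force `0` is fixed). [cite: MajdaBertozziCUP2002, §1.2 Prop. 1.1 (iii)] -/
theorem isClassicalNSSolutionOn_conj {ν T : ℝ} (hT : 0 < T)
    {v : ℝ → EuclideanSpace ℝ (Fin 3) → EuclideanSpace ℝ (Fin 3)} {q : ℝ → EuclideanSpace ℝ (Fin 3) → ℝ}
    (h : IsClassicalNSSolutionOn (Icc 0 T) ν 0 v q)
    (g : EuclideanSpace ℝ (Fin 3) ≃ₗᵢ[ℝ] EuclideanSpace ℝ (Fin 3)) :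
    IsClassicalNSSolutionOn (Icc 0 T) ν 0 (fun t x => g (v t (g.symm x))) (fun t x => q t (g.symm x)) :=
  (h.conj_linearIsometryEquiv (R := g) (uniqueDiffOn_Icc hT)).congr_force fun t _ x => by simp

/-- The velocity bound is invariant under a rigid reading. [folklore] -/
theorem bound_conjSlice {T : ℝ} {u : ℝ → EuclideanSpace ℝ (Fin 3) → EuclideanSpace ℝ (Fin 3)}
    (hb : ∃ C : ℝ, ∀ t ∈ Icc 0 T, ∀ x, ‖u t x‖ ≤ C)
    (A : EuclideanSpace ℝ (Fin 3) ≃ₗᵢ[ℝ] EuclideanSpace ℝ (Fin 3)) (b : EuclideanSpace ℝ (Fin 3)) :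
    ∃ C : ℝ, ∀ t ∈ Icc 0 T, ∀ x, ‖conjSlice A b (u t) x‖ ≤ C := by
  obtain ⟨C, hC⟩ := hb
  refine ⟨C, fun t ht x => ?_⟩
  simp only [conjSlice, LinearIsometryEquiv.norm_map]
  exact hC t ht _

/-- The velocity bound is invariant under isometry conjugation. [folklore] -/
theorem bound_conj {T : ℝ} {v : ℝ → EuclideanSpace ℝ (Fin 3) → EuclideanSpace ℝ (Fin 3)}
    (hb : ∃ C : ℝ, ∀ t ∈ Icc 0 T, ∀ x, ‖v t x‖ ≤ C)
    (g : EuclideanSpace ℝ (Fin 3) ≃ₗᵢ[ℝ] EuclideanSpace ℝ (Fin 3)) :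
    ∃ C : ℝ, ∀ t ∈ Icc 0 T, ∀ x, ‖g (v t (g.symm x))‖ ≤ C := by
  obtain ⟨C, hC⟩ := hb
  refine ⟨C, fun t ht x => ?_⟩
  rw [LinearIsometryEquiv.norm_map]
  exact hC t ht _

/-- The energy bound is invariant under a rigid reading (Lebesgue measure is invariant under `x ↦ A x + b`). [folklore] -/
theorem energy_conjSlice {T : ℝ} {u : ℝ → EuclideanSpace ℝ (Fin 3) → EuclideanSpace ℝ (Fin 3)}
    (he : ∃ E₀ : ℝ≥0∞, E₀ < ⊤ ∧ ∀ t ∈ Icc 0 T, ∫⁻ x, ‖u t x‖ₑ ^ 2 ≤ E₀)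
    (A : EuclideanSpace ℝ (Fin 3) ≃ₗᵢ[ℝ] EuclideanSpace ℝ (Fin 3)) (b : EuclideanSpace ℝ (Fin 3)) :
    ∃ E₀ : ℝ≥0∞, E₀ < ⊤ ∧ ∀ t ∈ Icc 0 T, ∫⁻ x, ‖conjSlice A b (u t) x‖ₑ ^ 2 ≤ E₀ := by
  obtain ⟨E₀, hE, hC⟩ := he
  refine ⟨E₀, hE, fun t ht => ?_⟩
  have h1 : (∫⁻ x, ‖conjSlice A b (u t) x‖ₑ ^ 2) = ∫⁻ x, ‖u t (A x + b)‖ₑ ^ 2 := by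
    refine lintegral_congr fun x => ?_
    simp only [conjSlice, LinearIsometryEquiv.enorm_map]
  have h2 : (∫⁻ x, ‖u t (A x + b)‖ₑ ^ 2) = ∫⁻ x, ‖u t (x + b)‖ₑ ^ 2 :=
    lintegral_comp_linearIsometryEquiv A (fun x => ‖u t (x + b)‖ₑ ^ 2)
  have h3 : (∫⁻ x, ‖u t (x + b)‖ₑ ^ 2) = ∫⁻ x, ‖u t x‖ₑ ^ 2 :=
    lintegral_add_right_eq_self (μ := volume) (fun x => ‖u t x‖ₑ ^ 2) b
  rw [h1, h2, h3]
  exact hC t ht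

/-- The energy bound is invariant under isometry conjugation. [folklore] -/
theorem energy_conj {T : ℝ} {v : ℝ → EuclideanSpace ℝ (Fin 3) → EuclideanSpace ℝ (Fin 3)}
    (he : ∃ E₀ : ℝ≥0∞, E₀ < ⊤ ∧ ∀ t ∈ Icc 0 T, ∫⁻ x, ‖v t x‖ₑ ^ 2 ≤ E₀)
    (g : EuclideanSpace ℝ (Fin 3) ≃ₗᵢ[ℝ] EuclideanSpace ℝ (Fin 3)) :
    ∃ E₀ : ℝ≥0∞, E₀ < ⊤ ∧ ∀ t ∈ Icc 0 T, ∫⁻ x, ‖g (v t (g.symm x))‖ₑ ^ 2 ≤ E₀ := by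
  obtain ⟨E₀, hE, hC⟩ := he
  refine ⟨E₀, hE, fun t ht => ?_⟩
  have h1 : (∫⁻ x, ‖g (v t (g.symm x))‖ₑ ^ 2) = ∫⁻ x, ‖v t (g.symm x)‖ₑ ^ 2 := by
    refine lintegral_congr fun x => ?_
    rw [LinearIsometryEquiv.enorm_map]
  rw [h1, lintegral_comp_linearIsometryEquiv g.symm (fun x => ‖v t x‖ₑ ^ 2)]
  exact hC t ht

/-- **Equivariance at the final time transports to the datum** (the backward-uniqueness step): for a free classical
bounded finite-energy solution `v` on `[0, T]` and a linear isometry `g`, if `v(T)` is fixed by conjugation with `g`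
then so is `v(0)`. [cite: BardosTartar1973, Thm. II.1] -/
theorem conj_eq_at_zero_of_conj_eq_at_T (hBU : NSBackwardUniquenessFE) {ν T : ℝ} (hν : 0 < ν) (hT : 0 < T)
    {v : ℝ → EuclideanSpace ℝ (Fin 3) → EuclideanSpace ℝ (Fin 3)} {q : ℝ → EuclideanSpace ℝ (Fin 3) → ℝ}
    (h : IsClassicalNSSolutionOn (Icc 0 T) ν 0 v q)
    (hb : ∃ C : ℝ, ∀ t ∈ Icc 0 T, ∀ x, ‖v t x‖ ≤ C)
    (he : ∃ E₀ : ℝ≥0∞, E₀ < ⊤ ∧ ∀ t ∈ Icc 0 T, ∫⁻ x, ‖v t x‖ₑ ^ 2 ≤ E₀)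
    (g : EuclideanSpace ℝ (Fin 3) ≃ₗᵢ[ℝ] EuclideanSpace ℝ (Fin 3))
    (hfix : ∀ x, g (v T (g.symm x)) = v T x) :
    ∀ x, g (v 0 (g.symm x)) = v 0 x := by
  have key := hBU ν T (fun t x => g (v t (g.symm x))) v (fun t x => q t (g.symm x)) q hν hT
    (isClassicalNSSolutionOn_conj hT h g) h (bound_conj hb g) hb (energy_conj he g) he (funext hfix)
  exact fun x => congrFun key x

/-- **S3 from backward uniqueness** (v4): along an UNFORCED registered design a live datum has live readout slices —
a dead slice at `τ_k` is, in some rigid placement `(A, b)`, axisymmetric AND swirl-free, i.e. fixed by conjugation with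
every rotation about the axis (`isAxisymmetric_iff_conj_rotZLIE`) and with the meridian reflection
(`IsAxisymmetric.conj_reflY_eq`); the placed run is a free classical bounded finite-energy solution
(`isClassicalNSSolutionOn_conjSlice`, `Stage.ceiling`, `Stage.energy`), so by `NSBackwardUniquenessFE` the placed
DATUM is fixed by the same conjugations, hence axisymmetric and swirl-free
(`IsAxisymmetric.hasNoSwirl_of_conj_reflY_eq`): the datum is dead. [cite: BardosTartar1973, Thm. II.1] -/
theorem liveDatumPropagatesT_of_backwardUniqueness (hBU : NSBackwardUniquenessFE) : LiveDatumPropagatesT := by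
  intro S hf k s hlive hdead
  apply hlive
  obtain ⟨A, b, hax, hsw⟩ := hdead
  have hτ : 0 < S.τ k := S.τ_pos k
  -- the placed run
  set v : ℝ → EuclideanSpace ℝ (Fin 3) → EuclideanSpace ℝ (Fin 3) := fun t => conjSlice A b (s.u t) with hv
  have hcl0 : IsClassicalNSSolutionOn (Icc 0 (S.τ k)) 1 0 s.u s.p := by
    have h := s.classical
    rw [hf] at h
    exact h
  have hcl : IsClassicalNSSolutionOn (Icc 0 (S.τ k)) 1 0 v (fun t x => s.p t (A x + b)) :=
    isClassicalNSSolutionOn_conjSlice hτ hcl0 A b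
  have hb : ∃ C : ℝ, ∀ t ∈ Icc 0 (S.τ k), ∀ x, ‖v t x‖ ≤ C :=
    bound_conjSlice ⟨S.c₂ * TowerRates.tuned.Y k, fun t ht x => s.ceiling k le_rfl t ht x⟩ A b
  have he : ∃ E₀ : ℝ≥0∞, E₀ < ⊤ ∧ ∀ t ∈ Icc 0 (S.τ k), ∫⁻ x, ‖v t x‖ₑ ^ 2 ≤ E₀ :=
    energy_conjSlice s.energy A b
  have hvT : v (S.τ k) = conjSlice A b (s.u (S.τ k)) := rfl
  have hv0 : v 0 = conjSlice A b S.u₀ := by simp only [hv, s.initial]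
  -- rotations about the axis
  have hrot : ∀ θ x, rotZLIE θ (v 0 ((rotZLIE θ).symm x)) = v 0 x := fun θ =>
    conj_eq_at_zero_of_conj_eq_at_T hBU one_pos hτ hcl hb he (rotZLIE θ)
      (fun x => by rw [hvT]; exact (isAxisymmetric_iff_conj_rotZLIE _).1 hax θ x)
  have hax0 : IsAxisymmetric (v 0) := (isAxisymmetric_iff_conj_rotZLIE _).2 hrot
  -- the meridian reflection
  have hrefl : ∀ x, reflY (v 0 (reflY.symm x)) = v 0 x :=
    conj_eq_at_zero_of_conj_eq_at_T hBU one_pos hτ hcl hb he reflY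
      (fun x => by rw [hvT]; exact hax.conj_reflY_eq hsw x)
  have hsw0 : HasNoSwirl (v 0) := hax0.hasNoSwirl_of_conj_reflY_eq hrefl
  rw [hv0] at hax0 hsw0
  exact ⟨A, b, hax0, hsw0⟩

end S3Reduction

/-- **S3 from the Literature fact, by name** (v5; no stub): backward uniqueness of bounded finite-energy classical
solutions ⇒ live data stay live along unforced registered designs. [cite: BardosTartar1973, Thm. II.1] -/
theorem liveDatumPropagatesT_of_literature (hBU : ns_backward_uniqueness_finiteEnergy) : LiveDatumPropagatesT :=
  liveDatumPropagatesT_of_backwardUniqueness (nsBackwardUniquenessFE_of_literature hBU)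

/-- **S3 is a TREE THEOREM** (v7; landed p552342 by ns-blowup-refuter4 K224,
`Theorems/HeredityAtOneT/Negative/DeadSliceBackwardStage.lean`, no named fact: backward uniqueness in the `L²`-Sobolev class
after Temam + Tao's class for every registered unforced stage). [cite: Temam1997, Ch. III §6.2 with Lemma 6.2 (pp. 172–175)] -/
theorem liveDatumPropagatesT_holds : LiveDatumPropagatesT :=
  Summit.NavierStokesRegularity.HeredityAtOneTDeadSliceBackwardStage.liveDatumPropagates TowerRates.tuned

/-- **S4 is a THEOREM** (landed p543875 by ns-blowup-refuter4 K218, `Theorems/HeredityAtOneT/Negative/LiveConfinedDataDense.lean`: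
`a = u₀ + δ·curl(χ·v_ABC)`, helicity density at the origin a quadratic in `δ` with leading coefficient `3`; an independent
proof with the germ `curl-type (φ_r·(y₀ + y₁y₂))` is attached as evidence #30 on stmt-…-20303).
[cite: MajdaBertozziCUP2002, §2.3.2 Example 2.8 eq. (2.49)] -/
theorem liveConfinedDataDense_holds : LiveConfinedDataDense :=
  Summit.NavierStokesRegularity.HeredityAtOneTLiveConfinedDense.liveConfinedDataDense

/-! ## §2 Compositions (sorry-free) -/

/-- Compact support and smoothness give rapid decay (all derivatives vanish outside the ball). [folklore] -/
theorem hasRapidSpatialDecay_of_confined {u₀ : EuclideanSpace ℝ (Fin 3) → EuclideanSpace ℝ (Fin 3)} {r : ℝ}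
    (hu₀ : ContDiff ℝ ∞ u₀) (hconf : ∀ x, r < ‖x‖ → u₀ x = 0) : HasRapidSpatialDecay u₀ := by
  have hsupp : HasCompactSupport u₀ := by
    refine HasCompactSupport.of_support_subset_isCompact (isCompact_closedBall (0 : EuclideanSpace ℝ (Fin 3)) r) ?_
    intro x hx
    rw [Metric.mem_closedBall, dist_zero_right]
    by_contra h
    exact hx (hconf x (lt_of_not_ge h))
  exact HasRapidSpatialDecay.of_hasCompactSupport hu₀ hsupp

/-- **T1 ∧ T2 ⇒ S1**: the sterile certificate with slack and the shadow lemma give the ROBUST swirl-free rung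
(the sterile datum itself is `ε`-close to itself, and the design the shadow lemma returns for it is swirl-free and
unforced). [cite: Palasek2026ElementaryModel, §4] -/
theorem robustNoSwirlRungAtOneT_of (h₁ : SlackFacesT) (h₂ : ShadowRegistersT) : RobustNoSwirlRungAtOneT := by
  obtain ⟨u₀, r, r₁, hr₁, hr₁r, hu₀, hdiv, hconf, hA, hS, hF⟩ := h₁
  obtain ⟨ε, hε, hopen⟩ := h₂ u₀ r r₁ hr₁ hr₁r hu₀ hdiv hconf hF
  have hdec : HasRapidSpatialDecay u₀ := hasRapidSpatialDecay_of_confined hu₀ hconf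
  obtain ⟨S, hSu₀, hSf, hSrad, hP, hR, hQ, hs⟩ := hopen u₀ hu₀ hdiv hdec hconf
    (fun x => by simp [hε.le]) (fun x => by simp [hε.le])
  refine ⟨S, hP, hR, hQ, ?_, hSf, ?_, hs, ε, hε, ?_⟩
  · refine ⟨?_, ?_, ?_, ?_⟩
    · rw [hSu₀]; exact hA
    · rw [hSu₀]; exact hS
    · intro t _ θ x; rw [hSf]; ext i; fin_cases i <;> simp
    · intro t _ x; rw [hSf]; simp [swirl]
  · rw [hSrad]; exact lt_of_lt_of_le hr₁ hr₁r
  · intro a ha hadiv hadec haconf ha0 ha1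
    rw [hSrad] at haconf
    rw [hSu₀] at ha0 ha1
    obtain ⟨S', h1, h2, -, h4, h5, h6, h7⟩ := hopen a ha hadiv hadec haconf ha0 ha1
    exact ⟨S', h1, h2, h4, h5, h6, h7⟩

/-- A robust swirl-free rung is in particular a swirl-free rung (K201's witness class `NoSwirlRungAtOneT`,
`HeredityFromTwoTFalseOfNoSwirlRungT` §2). [folklore] -/
theorem noSwirlRungAtOneT_of_robust (h : RobustNoSwirlRungAtOneT) : NoSwirlRungAtOneT := by
  obtain ⟨S, hP, hR, hQ, hN, -, -, hs, -⟩ := h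
  exact ⟨S, hP, hR, hQ, hN, hs⟩

/-- **LINE «sterileshadow» for the crux of record 20303, concluding it BY NAME**: sterile 2-D certificate with slack
(T1) + shadow lemma (T2) ⇒ a registered swirl-free level-1 design ⇒ `EpisodeBaseT` (`⟨S, Pins, Rigid, Quiet, ⟨s⟩⟩`).
For `EpisodeBaseT` ALONE the shadow lemma is used only at the certified datum itself (assembly); its openness
powers the live and the negative corollaries below. [cite: Palasek2026ElementaryModel, §4] -/
theorem EpisodeBaseT_of (h₁ : SlackFacesT) (h₂ : ShadowRegistersT) : PalasekTowerBreakdown.EpisodeBaseT := by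
  obtain ⟨S, hP, hR, hQ, -, hs⟩ := noSwirlRungAtOneT_of_robust (robustNoSwirlRungAtOneT_of h₁ h₂)
  exact ⟨S, hP, hR, hQ, hs⟩

/-- **A LIVE registering design from a robust sterile one**: S1 + S4 give a pinned rigid quiet unforced tuned
design with a NON-DEAD datum registering level 1, `ε₂`-close in `L³` to the sterile datum for any prescribed
`ε₂ > 0`. [cite: Palasek2026ElementaryModel, §4] -/
theorem exists_live_rung_near (h₁ : RobustNoSwirlRungAtOneT) (h₄ : LiveConfinedDataDense) {ε₂ : ℝ}
    (hε₂ : 0 < ε₂) :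
    ∃ (S S' : Schedule TowerRates.tuned)
      (_ : Stage 1 TowerRates.tuned S (Margins.routeG TowerRates.tuned) 1)
      (_ : Stage 1 TowerRates.tuned S' (Margins.routeG TowerRates.tuned) 1),
      NoSwirlDesign S ∧ S'.Pins 8 (6 / 5) ∧ S'.Rigid ∧ S'.Quiet ∧ S'.f = 0 ∧ ¬ DeadSlice S'.u₀ ∧
      ContDiff ℝ ∞ S'.u₀ ∧ VectorCalculus.IsDivFree S'.u₀ ∧ HasRapidSpatialDecay S'.u₀ ∧
      eLpNorm (S'.u₀ - S.u₀) 3 volume < ENNReal.ofReal ε₂ := by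
  obtain ⟨S, hP, hR, hQ, hN, hf, hrad, ⟨s⟩, ε₁, hε₁, hopen⟩ := h₁
  have hsm : ContDiff ℝ ∞ S.u₀ := s.contDiff_datum
  have hdiv : VectorCalculus.IsDivFree S.u₀ := by
    rw [← s.initial]; exact s.classical.divFree 0 ⟨le_rfl, (S.τ_pos 1).le⟩
  obtain ⟨a, ha, hadiv, hadec, haconf, ha0, ha1, haL3, halive⟩ :=
    h₄ S.u₀ S.radius (min ε₁ ε₂) hrad (lt_min hε₁ hε₂) hsm hdiv hP.datum_confined
  obtain ⟨S', hu₀', hf', hP', hR', hQ', ⟨s'⟩⟩ := hopen a ha hadiv hadec haconf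
    (fun x => (ha0 x).trans (min_le_left _ _)) (fun x => (ha1 x).trans (min_le_left _ _))
  have haL3' : eLpNorm (a - S.u₀) 3 volume < ENNReal.ofReal ε₂ :=
    lt_of_lt_of_le haL3 (ENNReal.ofReal_le_ofReal (min_le_right _ _))
  refine ⟨S, S', s, s', hN, hP', hR', hQ', hf', ?_, ?_, ?_, ?_, ?_⟩
  · rw [hu₀']; exact halive
  · rw [hu₀']; exact ha
  · rw [hu₀']; exact hadiv
  · rw [hu₀']; exact hadec
  · rw [hu₀']; exact haL3'

/-- **The SHELF base `LiveEpisodeBaseT` from the sterile certificate** (S1 via T1+T2, S3, S4): the δ-swirl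
perturbation of the certified sterile design registers and is LIVE at `τ₁`. So `EpisodeBaseT` and its live repair
are BOTH 2-D computations plus bookkeeping; the helicity rider «≠ 0» excludes nothing. [cite: Palasek2026ElementaryModel, §4] -/
theorem liveEpisodeBaseT_of (h₁ : RobustNoSwirlRungAtOneT) (h₃ : LiveDatumPropagatesT)
    (h₄ : LiveConfinedDataDense) : LiveEpisodeBaseT := by
  obtain ⟨-, S', -, s', -, hP', hR', hQ', hf', hlive, -⟩ := exists_live_rung_near h₁ h₄ one_pos
  exact ⟨S', hP', hR', hQ', s', h₃ S' hf' 1 s' hlive⟩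

/-- **A LIVE, GLOBALLY REGULAR registering design** (S1, S2, S4): choose the live perturbation inside the GIP ball of
the sterile datum. [cite: GallagherIftimiePlanchon2003, Thm. 0.1 (p. 1389)] -/
theorem exists_live_global_rung (h₁ : RobustNoSwirlRungAtOneT) (h₂ : SterileGlobalOpenT)
    (h₄ : LiveConfinedDataDense) :
    ∃ (S' : Schedule TowerRates.tuned)
      (_ : Stage 1 TowerRates.tuned S' (Margins.routeG TowerRates.tuned) 1)
      (U : ℝ → EuclideanSpace ℝ (Fin 3) → EuclideanSpace ℝ (Fin 3)) (P : ℝ → EuclideanSpace ℝ (Fin 3) → ℝ),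
      S'.Pins 8 (6 / 5) ∧ S'.Rigid ∧ S'.Quiet ∧ S'.f = 0 ∧ ¬ DeadSlice S'.u₀ ∧
      IsClassicalNSSolutionOn (Ici 0) 1 S'.f U P ∧ U 0 = S'.u₀ ∧ HasBoundedEnergy U := by
  obtain ⟨S, -, -, -, hN, -, -, ⟨s⟩, -⟩ := id h₁
  have hsm : ContDiff ℝ ∞ S.u₀ := s.contDiff_datum
  have hdiv : VectorCalculus.IsDivFree S.u₀ := by
    rw [← s.initial]; exact s.classical.divFree 0 ⟨le_rfl, (S.τ_pos 1).le⟩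
  obtain ⟨ε₂, hε₂, hglob⟩ := h₂ S.u₀ hsm hdiv S.datum_decay hN.1 hN.2.1
  -- rerun the choice of the live perturbation inside the GIP ball of THIS sterile datum
  obtain ⟨S₀, hP, hR, hQ, hN₀, hf, hrad, ⟨s₀⟩, ε₁, hε₁, hopen⟩ := h₁
  have hsm₀ : ContDiff ℝ ∞ S₀.u₀ := s₀.contDiff_datum
  have hdiv₀ : VectorCalculus.IsDivFree S₀.u₀ := by
    rw [← s₀.initial]; exact s₀.classical.divFree 0 ⟨le_rfl, (S₀.τ_pos 1).le⟩
  obtain ⟨ε₃, hε₃, hglob₀⟩ := h₂ S₀.u₀ hsm₀ hdiv₀ S₀.datum_decay hN₀.1 hN₀.2.1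
  obtain ⟨a, ha, hadiv, hadec, haconf, ha0, ha1, haL3, halive⟩ :=
    h₄ S₀.u₀ S₀.radius (min ε₁ ε₃) hrad (lt_min hε₁ hε₃) hsm₀ hdiv₀ hP.datum_confined
  obtain ⟨S', hu₀', hf', hP', hR', hQ', ⟨s'⟩⟩ := hopen a ha hadiv hadec haconf
    (fun x => (ha0 x).trans (min_le_left _ _)) (fun x => (ha1 x).trans (min_le_left _ _))
  have haL3' : eLpNorm (a - S₀.u₀) 3 volume < ENNReal.ofReal ε₃ :=
    lt_of_lt_of_le haL3 (ENNReal.ofReal_le_ofReal (min_le_right _ _))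
  obtain ⟨U, P, hcl, hU0, hE⟩ := hglob₀ a ha hadiv hadec haL3'
  refine ⟨S', s', U, P, hP', hR', hQ', hf', ?_, ?_, ?_, hE⟩
  · rw [hu₀']; exact halive
  · rw [hf']; exact hcl
  · rw [hU0, hu₀']

/-- **THE LIVE PAIR DIES TOO.** Robust mirror + openness of global regularity + live propagation + live density
⇒ `¬ (LiveHeredityAtOneT ∧ LiveHeredityFromTwoT)`: the live global design registers level 1, its ladder breaks at
a definite rung `k ≥ 1` (`Schedule.exists_last_level_of_global_classical`), and the stage at that rung is LIVE, so
whichever live heredity owns the rung is contradicted. The SHELF repair of the route does not survive a ROBUST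
sterile registration. [cite: GallagherIftimiePlanchon2003, Thm. 0.1 (p. 1389)] [cite: Tao2011, Cor. 11.4] -/
theorem not_liveHeredityPairT_of (h₁ : RobustNoSwirlRungAtOneT) (h₂ : SterileGlobalOpenT)
    (h₃ : LiveDatumPropagatesT) (h₄ : LiveConfinedDataDense) :
    ¬ (LiveHeredityAtOneT ∧ LiveHeredityFromTwoT) := by
  rintro ⟨hA, hF⟩
  obtain ⟨S', s', U, P, hP', hR', hQ', hf', hlive0, hcl, hU0, hE⟩ := exists_live_global_rung h₁ h₂ h₄
  obtain ⟨k, hk, ⟨sk⟩, hemp⟩ := S'.exists_last_level_of_global_classical one_pos s' hcl hU0 hE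
  have hlive : LiveStageAt TowerRates.tuned S' sk := h₃ S' hf' k sk hlive0
  rcases Nat.lt_or_ge k 2 with hlt | hge
  · obtain rfl : k = 1 := by omega
    obtain ⟨s'', -⟩ := hA S' hP' hR' hQ' sk hlive
    exact hemp.false s''
  · obtain ⟨s'', -⟩ := hF S' hP' hR' hQ' k hge sk hlive
    exact hemp.false s''

/-- … hence also the items of record: `¬ (HeredityAtOneT ∧ HeredityFromTwoT)` (the live heredities are weaker).
[cite: Palasek2026ElementaryModel, §4] -/
theorem not_heredityPairT_of (h₁ : RobustNoSwirlRungAtOneT) (h₂ : SterileGlobalOpenT)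
    (h₃ : LiveDatumPropagatesT) (h₄ : LiveConfinedDataDense) :
    ¬ (PalasekTowerBreakdown.HeredityAtOneT ∧ PalasekTowerBreakdown.HeredityFromTwoT) := by
  rintro ⟨hA, hF⟩
  exact not_liveHeredityPairT_of h₁ h₂ h₃ h₄
    ⟨liveHeredityAtGAt_of_heredityAtGAt hA, liveHeredityFromGAt_of_heredityFromGAt hF⟩

/-- The cheap half needs no analysis at all: a robust sterile rung is a sterile rung, and K201 already kills the
pair of record from that. [cite: LemarieRieusset2016, Thm 10.4 (p. 285)] -/
theorem not_heredityPairT_of_robust (h₁ : RobustNoSwirlRungAtOneT) :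
    ¬ (PalasekTowerBreakdown.HeredityAtOneT ∧ PalasekTowerBreakdown.HeredityFromTwoT) := fun h =>
  not_noSwirlRungAtOneT_of_heredity_pair h.1 h.2 (noSwirlRungAtOneT_of_robust h₁)

/-- **The four-binder SHELF closer cannot be fed from a robust sterile certificate**: under S1–S4 the hypotheses
`LiveHeredityAtOneT`, `LiveHeredityFromTwoT` of `closes_repairT` are jointly absurd (so `closes_repairT` would
prove (C) from `False`). Recorded as the typed form of «SHELF-T is not a repair». [folklore] -/
theorem closes_repairT_vacuous_of (h₁ : RobustNoSwirlRungAtOneT) (h₂ : SterileGlobalOpenT)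
    (h₃ : LiveDatumPropagatesT) (h₄ : LiveConfinedDataDense)
    (hA : LiveHeredityAtOneT) (hF : LiveHeredityFromTwoT) : False :=
  not_liveHeredityPairT_of h₁ h₂ h₃ h₄ ⟨hA, hF⟩

/-- **THE DECIDER IN ONE LINE.** Given the three in-print statements S2–S4, a ROBUST swirl-free level-1
registration decides everything at once: the crux of record `EpisodeBaseT` AND its SHELF twin `LiveEpisodeBaseT`
hold, and the SHELF pair `LiveHeredityAtOneT ∧ LiveHeredityFromTwoT` (hence the pair of record) is refuted — so
on the YES branch the route `PalasekTowerBreakdown` cannot be repaired by any live-class excision, and on the NO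
branch (no swirl-free design registers even non-robustly) swirl / three-dimensionality is NECESSARY for the level-1
faces, which is what the constructive search (DIRECTOR-NS #58) should then assume. [cite: Palasek2026ElementaryModel, §4] -/
theorem robust_mirror_decides (h₃ : LiveDatumPropagatesT) (h₁ : RobustNoSwirlRungAtOneT) :
    (PalasekTowerBreakdown.EpisodeBaseT ∧ LiveEpisodeBaseT) ∧ ¬ (LiveHeredityAtOneT ∧ LiveHeredityFromTwoT) ∧
      ¬ (PalasekTowerBreakdown.HeredityAtOneT ∧ PalasekTowerBreakdown.HeredityFromTwoT) := by
  refine ⟨⟨?_, liveEpisodeBaseT_of h₁ h₃ liveConfinedDataDense_holds⟩,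
    not_liveHeredityPairT_of h₁ sterileGlobalOpenT_holds h₃ liveConfinedDataDense_holds,
    not_heredityPairT_of h₁ sterileGlobalOpenT_holds h₃ liveConfinedDataDense_holds⟩
  obtain ⟨S, hP, hR, hQ, -, hs⟩ := noSwirlRungAtOneT_of_robust h₁
  exact ⟨S, hP, hR, hQ, hs⟩

/-- **The SHELF pair dies from TWO statements** (S2, S4 discharged): robust sterile registration + live-datum
propagation (backward uniqueness) ⇒ `¬ (LiveHeredityAtOneT ∧ LiveHeredityFromTwoT)`. -/
theorem not_liveHeredityPairT_of₂ (h₁ : RobustNoSwirlRungAtOneT) (h₃ : LiveDatumPropagatesT) :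
    ¬ (LiveHeredityAtOneT ∧ LiveHeredityFromTwoT) :=
  not_liveHeredityPairT_of h₁ sterileGlobalOpenT_holds h₃ liveConfinedDataDense_holds

/-- **The SHELF base from TWO statements**: robust sterile registration + live-datum propagation ⇒ `LiveEpisodeBaseT`. -/
theorem liveEpisodeBaseT_of₂ (h₁ : RobustNoSwirlRungAtOneT) (h₃ : LiveDatumPropagatesT) : LiveEpisodeBaseT :=
  liveEpisodeBaseT_of h₁ h₃ liveConfinedDataDense_holds

/-- **From the certificate pair** (T1, T2) **and the two live statements** (S3, S4): the SHELF repair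
`closes_repairAt` at the tuned rates has a vacuous antecedent pair. -/
theorem not_liveHeredityPairT_of_certificate (hT₁ : SlackFacesT) (hT₂ : ShadowRegistersT)
    (h₃ : LiveDatumPropagatesT) : ¬ (LiveHeredityAtOneT ∧ LiveHeredityFromTwoT) :=
  not_liveHeredityPairT_of₂ (robustNoSwirlRungAtOneT_of hT₁ hT₂) h₃

/-- **v5 bottom line, modulo the TWO stubs T1/T2 and the Literature fact BY NAME:** the SHELF pair is refuted. -/
theorem not_liveHeredityPairT_of_certificate' (hBU : ns_backward_uniqueness_finiteEnergy) (hT₁ : SlackFacesT)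
    (hT₂ : ShadowRegistersT) : ¬ (LiveHeredityAtOneT ∧ LiveHeredityFromTwoT) :=
  not_liveHeredityPairT_of_certificate hT₁ hT₂ (liveDatumPropagatesT_of_literature hBU)

/-- **v5 decider, modulo T1/T2 and the Literature fact BY NAME:** base of record AND shelf base hold, both heredity
pairs (shelf and of record) are refuted. -/
theorem robust_mirror_decides' (hBU : ns_backward_uniqueness_finiteEnergy) (hT₁ : SlackFacesT) (hT₂ : ShadowRegistersT) :
    (PalasekTowerBreakdown.EpisodeBaseT ∧ LiveEpisodeBaseT) ∧ ¬ (LiveHeredityAtOneT ∧ LiveHeredityFromTwoT) ∧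
      ¬ (PalasekTowerBreakdown.HeredityAtOneT ∧ PalasekTowerBreakdown.HeredityFromTwoT) :=
  robust_mirror_decides (liveDatumPropagatesT_of_literature hBU) (robustNoSwirlRungAtOneT_of hT₁ hT₂)

/-! ### v7 bottom lines: everything from the ONE remaining stub T1 (`SlackFacesT`) — no other hypothesis -/

/-- **ROBUST sterile registration from the certificate ALONE** (T2 discharged, v6). -/
theorem robustNoSwirlRungAtOneT_of₁ (hT₁ : SlackFacesT) : RobustNoSwirlRungAtOneT :=
  robustNoSwirlRungAtOneT_of hT₁ shadowRegistersT_holds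

/-- **THE CRUX OF RECORD FROM THE CERTIFICATE ALONE** (v6): `SlackFacesT → EpisodeBaseT` — a sterile free run with
slack faces closes stmt-NavierStokesRegularity-20303 by name, with no further Lean (cf. the unforced door
`Theorems.palasekTowerBreakdown_episodeBaseT_of_slackFaces`, which drops even the symmetry). -/
theorem EpisodeBaseT_of₁ (hT₁ : SlackFacesT) : PalasekTowerBreakdown.EpisodeBaseT :=
  EpisodeBaseT_of hT₁ shadowRegistersT_holds

/-- **THE SHELF PAIR DIES FROM THE CERTIFICATE ALONE** (v7; S3 by name, no Literature fact). -/
theorem not_liveHeredityPairT_of₁ (hT₁ : SlackFacesT) : ¬ (LiveHeredityAtOneT ∧ LiveHeredityFromTwoT) :=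
  not_liveHeredityPairT_of_certificate hT₁ shadowRegistersT_holds liveDatumPropagatesT_holds

/-- **THE SHELF BASE FROM THE CERTIFICATE ALONE** (v7): `SlackFacesT → LiveEpisodeBaseT` (δ-swirl next to the sterile
certificate, S4, then S3). -/
theorem liveEpisodeBaseT_of₁ (hT₁ : SlackFacesT) : LiveEpisodeBaseT :=
  liveEpisodeBaseT_of₂ (robustNoSwirlRungAtOneT_of₁ hT₁) liveDatumPropagatesT_holds

/-- **THE DECIDER FROM THE CERTIFICATE ALONE** (v7; every other input a tree theorem): base of record AND shelf base hold,
and both heredity pairs (shelf and of record) are refuted — the fork of DIRECTOR-NS #64 (4) is decided by T1 alone. -/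
theorem robust_mirror_decides₁ (hT₁ : SlackFacesT) :
    (PalasekTowerBreakdown.EpisodeBaseT ∧ LiveEpisodeBaseT) ∧ ¬ (LiveHeredityAtOneT ∧ LiveHeredityFromTwoT) ∧
      ¬ (PalasekTowerBreakdown.HeredityAtOneT ∧ PalasekTowerBreakdown.HeredityFromTwoT) :=
  robust_mirror_decides liveDatumPropagatesT_holds (robustNoSwirlRungAtOneT_of₁ hT₁)

/-- The v6 form with the (now redundant) Literature fact as an explicit hypothesis, kept for callers. -/
theorem robust_mirror_decides₁' (_hBU : ns_backward_uniqueness_finiteEnergy) (hT₁ : SlackFacesT) :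
    (PalasekTowerBreakdown.EpisodeBaseT ∧ LiveEpisodeBaseT) ∧ ¬ (LiveHeredityAtOneT ∧ LiveHeredityFromTwoT) ∧
      ¬ (PalasekTowerBreakdown.HeredityAtOneT ∧ PalasekTowerBreakdown.HeredityFromTwoT) :=
  robust_mirror_decides₁ hT₁

/-- **Unconditionally (v6): the pair of record is ALREADY refuted by the certificate alone** — no Literature fact:
`SlackFacesT → ¬ (HeredityAtOneT ∧ HeredityFromTwoT)` (K201 `not_heredityPairT_of_robust` ∘ T2). -/
theorem not_heredityPairT_of₁ (hT₁ : SlackFacesT) :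
    ¬ (PalasekTowerBreakdown.HeredityAtOneT ∧ PalasekTowerBreakdown.HeredityFromTwoT) :=
  not_heredityPairT_of_robust (robustNoSwirlRungAtOneT_of₁ hT₁)

end Summit.NavierStokesRegularity.NavierStokesRegularity.Cruxes.EpisodeBaseT.RobustMirror

end
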